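import Summits.QuantumFields.YangMills.Theorems.BalabanUVNodesN15TwoGridReadoutEntry1
import Summits.QuantumFields.YangMills.Theorems.BalabanUVNodesN15TwoGridEntry2
import HarnessLib

/-!
# N15 (NE2) — Bałaban's full propagator pair, part 72: ★★★ THE READOUT WITH NO DISPLAYED BINDER — `T4EtaRate.NE2ZeroOperator` ∕ `NE2PlusOperator` BY NAME for `(G′, G)` at `U ≡ 1`

WHO / WHEN.  Cell `pub-ymgap`, seat `pub-ymgap-dag-n15-a` (KNIT-BY-NAME, g13); `--supports stmt-QuantumFields-20507 --as helper` (count-neutral); `HOME/pub-ymgap-dag-n15-a/DOOR-IV-PLAN.md` §7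
(door (iv), the last step).  Over parts 60 (`ne2ZeroOperator_fullG_of_entry2`: the readout modulo entry 2, with entries 0∕1∕3 = parts 52∕59∕54 inside) and 71 (`hasMaj_twoGridDefect_div`: entry 2).
WHAT.  `tgT2 d hL a μ i := idef P P (G′∘ρ′(n′(s_μ⁻¹−1))) (G∘ρ(n(s_μ⁻¹−1)))` (the honest «G∇*» two-grid defect, one plumbing def), `hasMaj_tgT2` (part 71 in the `TGIndex` dress), and
★★★ **`ne2ZeroOperator_fullG`** ∕ **`ne2PlusOperator_fullG`**: `NE2ZeroOperator (tgInstance d hL) (tgFamily d hL a (tgT1 d hL a ν) (tgT2 d hL a μ))` and the «+» layer — the node's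
operator-layer Props BY NAME for Bałaban's full Landau-gauge pair `(G′, G) = (Δ′_a⁻¹, Δ_a⁻¹)` on the torus family of record, ALL FOUR entries of [B9] (3.42) honest (entry 0 `G′P − PG`,
entry 1 `∇′G′P − P∇G`, entry 2 `G′∇′*P − PG∇*`, entry 3 `Δ′G′P − PΔG`), NO displayed binder left: every analytic input is a tree theorem (b05 Prop. 1.2 via `prop12_famG_printed`, the
King∕Bałaban two-grid algebra of parts 34–71).
HONEST FRAMING ∕ LIMITS.  This is the `U ≡ 1` (flat, one-point background carrier) torus family: Bałaban's (3.42) is stated for general smooth backgrounds `U` with weighted norms; the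
regularity condition (3.35) is void at `U ≡ 1` (the «+» block is inert).  Count-neutral (typed 28∕28 · discharged 5∕27 of record unchanged); NOT a discharge of N15 (`NE2PlusOperator` of
record is object-bound to the programme's pair, not to this model pair); not ℝ⁴ ∕ OS ∕ mass gap ∕ Clay.
-/

open scoped BigOperators
open Finset

namespace Summit.QuantumFields.YangMills.BalabanUVNodes.N15.TwoGrid

open Literature.MathematicalPhysics.QuantumFieldTheory.Balaban1983to89
open Literature.MathematicalPhysics.QuantumFieldTheory.Balaban1983to89.B11SectG (BlockNorm HasMaj)
open Literature.MathematicalPhysics.QuantumFieldTheory.Balaban1983to89.T4EtaRate (NE2ZeroOperator NE2PlusOperator)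
open Literature.MathematicalPhysics.QuantumFieldTheory.Balaban1983to89.T4EtaRateDefect (idef)
open Literature.MathematicalPhysics.QuantumFieldTheory.Balaban1983to89.T4EtaRateCoeffDefect (pull)
open Literature.MathematicalPhysics.QuantumFieldTheory.Balaban1983to89.B5Prop11Plancherel (Tor fine)
open Literature.MathematicalPhysics.QuantumFieldTheory.King1986.Torus (blockOf tdistT tdistT_nonneg)
open Literature.MathematicalPhysics.QuantumFieldTheory.Balaban1983to89.B6UnitTorusCarrier (unitTorusGeo)
open Summit.QuantumFields.YangMills.BalabanUVNodes.N15.VectorPiece (blkFine kingPrV)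

variable {d : ℕ} {L : ℕ} [NeZero L]

/-- **THE HONEST `T2`**: the two-grid defect of «G∇_μ*» for the pair `(G′, G)` at the index `i = (m_T, k, m)`, `𝔇(G∇_μ*) = G′∇′_μ*P − PG∇_μ*`.
[cite: Balaban1985BackgroundPropagators, Thm 3.1 (3.42) p.397 (the entry G∇*)] -/
noncomputable def tgT2 (d : ℕ) (hL : Odd L ∧ 1 < L) (a : ℝ) (μ : Fin (d + 1)) (i : TGIndex) :
    (Tor (fine (L ^ i.k) (TGIndex.Mn d hL i)) × Fin (d + 1) → ℝ) →ₗ[ℝ] (Tor (fine (L ^ i.m * L ^ i.k) (TGIndex.Mn d hL i)) × Fin (d + 1) → ℝ) :=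
  idef (pull (kingPrV L i.k i.m (TGIndex.Mn d hL i))) (pull (kingPrV L i.k i.m (TGIndex.Mn d hL i)))
    (gOp (TGIndex.Mn d hL i) (L ^ i.m * L ^ i.k) a ∘ₗ
      symbOp (TGIndex.Mn d hL i) (L ^ i.m * L ^ i.k) (((L ^ i.m * L ^ i.k : ℕ) : ℝ) • (sTinv (TGIndex.Mn d hL i) (L ^ i.m * L ^ i.k) μ - 1)))
    (gOp (TGIndex.Mn d hL i) (L ^ i.k) a ∘ₗ symbOp (TGIndex.Mn d hL i) (L ^ i.k) (((L ^ i.k : ℕ) : ℝ) • (sTinv (TGIndex.Mn d hL i) (L ^ i.k) μ - 1)))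

/-- part 71's entry 2 in the `TGIndex` dress: `∃ δ C > 0 ∀ i, HasMaj … (tgT2 d hL a μ i) (C·(L^{i.k})^{−1∕(8(d+1))}·e^{−δd})`. [cite: Balaban1985BackgroundPropagators, Thm 3.1 (3.42) p.397] -/
theorem hasMaj_tgT2 (hLodd : Odd L) (hL2 : 2 ≤ L) (hL : Odd L ∧ 1 < L) {a : ℝ} (ha : 0 < a) (μ : Fin (d + 1)) :
    ∃ δ C : ℝ, 0 < δ ∧ 0 < C ∧ ∀ i : TGIndex,
      HasMaj (BlockNorm.ofBlocks (unitTorusGeo L i.k (TGIndex.Mn d hL i)) (blkFine L i.k (TGIndex.Mn d hL i)))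
        (BlockNorm.ofBlocks (unitTorusGeo L i.k (TGIndex.Mn d hL i))
          (fun j : Tor (fine (L ^ i.m * L ^ i.k) (TGIndex.Mn d hL i)) × Fin (d + 1) => blockOf (L ^ i.m * L ^ i.k) (TGIndex.Mn d hL i) j.1)) (tgT2 d hL a μ i)
        (fun y y' => C * ((L : ℝ) ^ i.k) ^ (-(1 / (8 * ((d : ℝ) + 1)))) * Real.exp (-(δ * tdistT (TGIndex.Mn d hL i) y y'))) := by
  obtain ⟨δ, C, hδ, hC, H⟩ := hasMaj_twoGridDefect_div (d := d) hLodd hL2 ha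
  refine ⟨δ, C, hδ, hC, fun i => ?_⟩
  have hcast : ((L ^ i.k : ℕ) : ℝ) = (L : ℝ) ^ i.k := by push_cast; ring
  refine (H i.mT i.k i.m i.one_le hL μ).mono fun y y' => le_of_eq ?_
  rw [hcast]
  rfl

/-- ★★★ **NE2⁰, OPERATOR LAYER — `T4EtaRate.NE2ZeroOperator` BY NAME — FOR BAŁABAN's FULL LANDAU-GAUGE PAIR `(G′, G)` AT `U ≡ 1`, NO DISPLAYED BINDER**: for odd `L ≥ 3`, `a > 0` and directions
`ν, μ` (entry 1's gradient direction, entry 2's divergence direction), the η-rate inequality (3.42) holds in `B11SectG.HasMaj` block-majorant currency with the honest four entries — `T1 = tgT1`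
(part 59), `T2 = tgT2` (part 71), entries 0 and 3 inside `tgFamily` (parts 52, 54). [cite: Balaban1985BackgroundPropagators, Thm 3.1 (3.42) p.397; King1986, Prop. 3.9 (3.73) p.665] -/
theorem ne2ZeroOperator_fullG (hLodd : Odd L) (hL2 : 2 ≤ L) (hL : Odd L ∧ 1 < L) {a : ℝ} (ha : 0 < a) (ν μ : Fin (d + 1)) :
    NE2ZeroOperator (tgInstance d hL) (tgFamily d hL a (tgT1 d hL a ν) (tgT2 d hL a μ)) := by
  obtain ⟨δ₂, C₂, hδ₂, hC₂, H2⟩ := hasMaj_tgT2 (d := d) hLodd hL2 hL ha μ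
  exact ne2ZeroOperator_fullG_of_entry2 (d := d) hLodd hL2 hL ha ν (tgT2 d hL a μ) (by positivity) hδ₂ H2

/-- ★★★ **NE2⁺, OPERATOR LAYER (the node's FIRST CONJUNCT `T4EtaRate.NE2PlusOperator` BY NAME) FOR `(G′, G)` AT `U ≡ 1`, NO DISPLAYED BINDER** (the regularity condition (3.35) is void at the
one-point background carrier: the «+» block is inert, the content is NE2⁰'s). [cite: Balaban1985BackgroundPropagators, Thm 3.1 p.397 (quantifier template)] -/
theorem ne2PlusOperator_fullG (hLodd : Odd L) (hL2 : 2 ≤ L) (hL : Odd L ∧ 1 < L) {a : ℝ} (ha : 0 < a) (c35 : ℝ) (ν μ : Fin (d + 1)) :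
    NE2PlusOperator c35 (tgInstance d hL) (tgFamily d hL a (tgT1 d hL a ν) (tgT2 d hL a μ)) := by
  obtain ⟨δ₂, C₂, hδ₂, hC₂, H2⟩ := hasMaj_tgT2 (d := d) hLodd hL2 hL ha μ
  exact ne2PlusOperator_fullG_of_entry2 (d := d) hLodd hL2 hL ha c35 ν (tgT2 d hL a μ) (by positivity) hδ₂ H2

end Summit.QuantumFields.YangMills.BalabanUVNodes.N15.TwoGrid
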